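import Literature.AlgebraicGeometry.Resolution.KummerRootPrime
import Literature.AlgebraicGeometry.Resolution.KummerToricAlgebraLocal
import HarnessLib

/-!
# The log structure of the Kummer toric algebra is divisorial (Kato 1994, Thm. 11.6)

Topic: `Literature/AlgebraicGeometry/Resolution`. For a regular local ring `O`, boundary
equations `x_j ∈ 𝔪` independent modulo `𝔪²`, and `c` with `c_{j₀} = 1`, the submonoid of the
toric algebra `T` (`KummerToricAlgebra*.lean`) generated by its units and the values of the
Kummer chart `P → T` (`KummerChart.lean`) is EXACTLY the divisorial monoid of the boundary
`∏ x_j` — the elements of `T` dividing a power of `∏ x_j`: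

  `divisorialMonoid (∏ x_j) = T^× · chart(P)`   (`divisorialMonoid_toric`),

K. Kato, *Toric singularities*, Amer. J. Math. 116 (1994), Thm. 11.6 (`M = 𝒪_X ∩ j_* 𝒪^*_U`)
for this chart. Proof: a divisor `t ∈ T` of `(∏ x_j)^N` is `u' s^k` in the regular root cover
`B'` (`KummerRootPrime.lean`); reading the coordinate at `k mod p` shows `k̄ ∈ 𝔽_p c̄` (else the
unit `u'` would have vanishing constant coordinate), so `s^k = chart(v)`; projecting onto `T`,
`t = proj(u') · chart(v)` with `proj(u') ≡ u'` modulo `(s)`, a unit of the local ring `T`.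
This is the `chartStalkMonoid = divisorialMonoid` condition of `LocalLogRegularChart` at a Kummer
point of the endgame of the crux `PicoverLocalModel`.

* `RootCover.coord_mul_boxMonomial_self`, `sub_proj_mem_span_root`, `liftNat` (cone lift of a
  Kummer `ℕ`-exponent) with `chart_liftNat`, `toricChart_dvd_pow`, `divisorialMonoid_toric`.

Sources: [Kato1994] K. Kato, Amer. J. Math. 116 (1994), (1.5), Def. (2.1), Thm. 11.6.
-/

noncomputable section

namespace Literature.AlgebraicGeometry.Resolution

open MvPolynomial IsLocalRing

namespace RootCover

variable {O : Type*} [CommRing O] {r : ℕ} {p : ℕ} [hp : Fact p.Prime] {x : Fin r → O}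
variable {j₀ : Fin r} {c : Fin r → ℕ}

/-! ## Coordinates and the projector -/

/-- The `n`-coordinate of `y · s^n` is the constant coordinate of `y`. [folklore] -/
theorem coord_mul_boxMonomial_self (y : RootCover p x) (n : Fin r → Fin p) :
    coord (y * boxMonomial p x n) n = coord y 0 := by
  rw [← rootMonomial_val, coord_mul_rootMonomial, Finset.sum_eq_single (0 : Fin r → Fin p)]
  · rw [if_pos]
    · rw [Finset.prod_eq_one fun j _ => by
        rw [Pi.zero_apply, Fin.val_zero, zero_add, Nat.div_eq_of_lt (n j).2, pow_zero], mul_one]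
    · ext j; simp [modBox', Nat.mod_eq_of_lt (n j).2]
  · intro m _ hm
    rw [if_neg]
    intro h
    apply hm
    ext j
    have hj := congrArg Fin.val (congrFun h j)
    simp only [modBox'] at hj
    have hmj : (m j : ℕ) < p := (m j).2
    have hnj : (n j : ℕ) < p := (n j).2
    simp only [Pi.zero_apply, Fin.val_zero]
    rcases lt_or_ge ((m j : ℕ) + n j) p with hlt | hge
    · rw [Nat.mod_eq_of_lt hlt] at hj
      omega
    · rw [Nat.mod_eq_sub_mod hge, Nat.mod_eq_of_lt (by omega)] at hj
      omega
  · intro h; exact absurd (Finset.mem_univ _) h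

/-- `y - proj y` lies in the ideal of the roots (it is a combination of non-empty monomials).
[folklore] -/
theorem sub_proj_mem_span_root (y : RootCover p x) :
    y - proj p x j₀ c y ∈ Ideal.span (Set.range (root p x)) := by
  classical
  have hsplit : y = proj p x j₀ c y +
      ∑ n ∈ Finset.univ.filter (fun n => ¬ IsKummerExp p j₀ c n), coord y n • boxMonomial p x n := by
    rw [proj_apply]
    conv_lhs => rw [← sum_coord_smul_boxMonomial y]
    exact (Finset.sum_filter_add_sum_filter_not _ _ _).symm
  have : y - proj p x j₀ c y =
      ∑ n ∈ Finset.univ.filter (fun n => ¬ IsKummerExp p j₀ c n), coord y n • boxMonomial p x n := by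
    rw [sub_eq_iff_eq_add']
    exact hsplit
  rw [this]
  refine Ideal.sum_mem _ fun n hn => ?_
  rw [Algebra.smul_def]
  refine Ideal.mul_mem_left _ _ ?_
  rw [← rootMonomial_val]
  refine rootMonomial_mem_span_root fun h0 => (Finset.mem_filter.mp hn).2 ?_
  have : n = 0 := by
    ext j; have := congrFun h0 j; simpa using this
  rw [this]; exact isKummerExp_zero

/-! ## Lifting Kummer `ℕ`-exponents to the cone -/

/-- The cone element with `kummerExp = k` for an exponent `k ∈ ℕʳ` whose reduction is a Kummer
exponent: `v_{j₀} = k_{j₀}`, `v_j = (k_j - c_j k_{j₀})/p`. [folklore] -/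
def liftNat (p : ℕ) (j₀ : Fin r) (c : Fin r → ℕ) (k : Fin r → ℕ) : Fin r → ℤ :=
  fun j => if j = j₀ then (k j₀ : ℤ) else ((k j : ℤ) - c j * k j₀) / p

omit hp in
/-- `kummerExp (liftNat k) = k`. [folklore] -/
theorem kummerExp_liftNat {k : Fin r → ℕ}
    (hk : ∀ j, ((k j : ℕ) : ZMod p) = (c j : ZMod p) * ((k j₀ : ℕ) : ZMod p)) :
    kummerExp p j₀ c (liftNat p j₀ c k) = fun j => (k j : ℤ) := by
  ext j
  by_cases hj : j = j₀
  · subst hj; rw [kummerExp_apply_self]; simp [liftNat]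
  · rw [kummerExp_apply_of_ne p c _ hj]
    simp only [liftNat, if_neg hj, if_true]
    have hdvd : (p : ℤ) ∣ (k j : ℤ) - c j * k j₀ := by
      have h := hk j
      rw [← Int.cast_natCast (k j), ← Int.cast_natCast (c j), ← Int.cast_natCast (k j₀),
        ← Int.cast_mul, eq_comm, ZMod.intCast_eq_intCast_iff_dvd_sub] at h
      exact h
    rw [Int.mul_ediv_cancel' hdvd]; ring

/-- The reduction of an `ℕ`-exponent is a Kummer exponent iff the congruences hold. [folklore] -/
theorem isKummerExp_modBox'_iff (k : Fin r → ℕ) :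
    IsKummerExp p j₀ c (modBox' (p := p) k) ↔
      ∀ j, ((k j : ℕ) : ZMod p) = (c j : ZMod p) * ((k j₀ : ℕ) : ZMod p) := by
  simp only [IsKummerExp, modBox', ZMod.natCast_mod]

omit hp in
/-- The lift lies in the cone. [folklore] -/
theorem liftNat_mem {k : Fin r → ℕ}
    (hk : ∀ j, ((k j : ℕ) : ZMod p) = (c j : ZMod p) * ((k j₀ : ℕ) : ZMod p)) :
    liftNat p j₀ c k ∈ kummerCone p j₀ c := by
  intro j; rw [kummerExp_liftNat hk]; positivity

omit hp in
/-- `natExp` of the lift is `k`. [folklore] -/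
theorem natExp_liftNat {k : Fin r → ℕ}
    (hk : ∀ j, ((k j : ℕ) : ZMod p) = (c j : ZMod p) * ((k j₀ : ℕ) : ZMod p)) :
    natExp p j₀ c ⟨liftNat p j₀ c k, liftNat_mem hk⟩ = k := by
  ext j
  apply Int.ofNat.inj
  change ((natExp p j₀ c _ j : ℕ) : ℤ) = (k j : ℤ)
  rw [natExp_cast]
  exact congrFun (kummerExp_liftNat hk) j

/-- Every monomial `s^k` with `k̄ ∈ 𝔽_p c̄` is a chart value. [cite: Kato1994, (2.2)(2)] -/
theorem chart_liftNat {k : Fin r → ℕ}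
    (hk : ∀ j, ((k j : ℕ) : ZMod p) = (c j : ZMod p) * ((k j₀ : ℕ) : ZMod p)) :
    chart p x j₀ c (Multiplicative.ofAdd ⟨liftNat p j₀ c k, liftNat_mem hk⟩) = rootMonomial p x k := by
  rw [chart_apply, toAdd_ofAdd, natExp_liftNat hk]

/-! ## Chart values divide powers of the boundary -/

omit hp in
/-- `s^{(pN, …, pN)} = (∏ x_j)^N`. [folklore] -/
theorem rootMonomial_const (N : ℕ) :
    rootMonomial p x (fun _ => p * N) = algebraMap O (RootCover p x) (∏ j, x j) ^ N := by
  rw [rootMonomial, map_prod, ← Finset.prod_pow]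
  exact Finset.prod_congr rfl fun j _ => by rw [pow_mul, root_pow]

/-- **Chart values divide a power of `∏ x_j` in the toric algebra.** [cite: Kato1994, Thm. 11.6] -/
theorem toricChart_dvd_pow (hc : c j₀ = 1) (v : Multiplicative (kummerCone p j₀ c)) :
    ∃ N : ℕ, toricChart p x j₀ c hc v ∣ algebraMap O (toric p x j₀ c) (∏ j, x j) ^ N := by
  set k := natExp p j₀ c v.toAdd with hkdef
  have hk := (isKummerExp_modBox'_iff k).mp (isKummerExp_modBox'_natExp hc v.toAdd)
  set N := ∑ j, k j with hN
  have hle : ∀ j, k j ≤ p * N := fun j =>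
    (Finset.single_le_sum (fun i _ => Nat.zero_le (k i)) (Finset.mem_univ j)).trans
      (Nat.le_mul_of_pos_left N hp.out.pos)
  let k' : Fin r → ℕ := fun j => p * N - k j
  have hk' : ∀ j, ((k' j : ℕ) : ZMod p) = (c j : ZMod p) * ((k' j₀ : ℕ) : ZMod p) := by
    intro j
    simp only [k', Nat.cast_sub (hle _), Nat.cast_mul, ZMod.natCast_self, zero_mul, zero_sub]
    rw [hk j]; ring
  refine ⟨N, ⟨toricChart p x j₀ c hc (Multiplicative.ofAdd ⟨liftNat p j₀ c k', liftNat_mem hk'⟩), ?_⟩⟩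
  apply Subtype.ext
  rw [Subalgebra.coe_mul, coe_toricChart, coe_toricChart, chart_liftNat hk', chart_apply, ← hkdef,
    ← rootMonomial_add, Subalgebra.coe_pow, Subalgebra.coe_algebraMap, ← rootMonomial_const]
  congr 1
  ext j
  simp only [Pi.add_apply, k', Nat.add_sub_cancel' (hle j)]

/-! ## The divisorial monoid of the toric algebra -/

/-- **Kato 1994, Thm. 11.6 for the Kummer chart: the divisorial monoid of the boundary in the
toric algebra is generated by the units and the chart.** For a regular local ring `O`, boundary
equations `x_j ∈ 𝔪` independent modulo `𝔪²` and `c_{j₀} = 1`: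
`{t ∈ T | t ∣ (∏ x_j)^N for some N} = T^× · chart(P)`. [cite: Kato1994, Thm. 11.6] -/
theorem divisorialMonoid_toric [IsRegularLocalRing O] (hx : ∀ j, x j ∈ maximalIdeal O)
    (hli : ∀ α : Fin r → O, ∑ i, α i * x i ∈ maximalIdeal O ^ 2 → ∀ i, α i ∈ maximalIdeal O)
    (hc : c j₀ = 1) :
    divisorialMonoid (Ideal.span {algebraMap O (toric p x j₀ c) (∏ j, x j)}) =
      IsUnit.submonoid (toric p x j₀ c) ⊔ MonoidHom.mrange (toricChart p x j₀ c hc) := by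
  classical
  haveI := isDomain_of_isRegularLocalRing O
  obtain ⟨hlocB, hlocT, hmaxT⟩ := toric_isLocalRing (p := p) (j₀ := j₀) (c := c) hx
  haveI := hlocB
  haveI := hlocT
  obtain ⟨_, hmaxB⟩ := isLocalRing (p := p) hx
  have hI : Ideal.span (Set.range x) ≤ maximalIdeal O :=
    Ideal.span_le.mpr (by rintro _ ⟨j, rfl⟩; exact hx j)
  haveI : Nontrivial (O ⧸ Ideal.span (Set.range x)) :=
    Ideal.Quotient.nontrivial_iff.mpr (ne_top_of_le_ne_top (maximalIdeal.isMaximal O).ne_top hI)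
  apply le_antisymm
  · intro t ht
    obtain ⟨N, t', htt'⟩ := mem_divisorialMonoid_span_singleton_iff.mp ht
    -- in the root cover: `t = u' s^k`
    have hdvd : (t : RootCover p x) ∣ algebraMap O (RootCover p x) (∏ j, x j) ^ N :=
      ⟨(t' : RootCover p x), by
        have := congrArg Subtype.val htt'
        simpa only [Subalgebra.coe_pow, Subalgebra.coe_mul, Subalgebra.coe_algebraMap] using this⟩
    obtain ⟨u', k, hu', htk⟩ := exists_unit_mul_rootMonomial_of_dvd (p := p) hx hli hdvd
    -- the reduced exponent is a Kummer exponent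
    have hk : ∀ j, ((k j : ℕ) : ZMod p) = (c j : ZMod p) * ((k j₀ : ℕ) : ZMod p) := by
      rw [← isKummerExp_modBox'_iff]
      by_contra hnot
      have h0 : coord (t : RootCover p x) (modBox' k) = 0 := (mem_toric_iff_coord.mp t.2) _ hnot
      rw [htk, rootMonomial_eq_smul_boxMonomial, mul_smul_comm, map_smul, Pi.smul_apply,
        coord_mul_boxMonomial_self, smul_eq_mul, mul_eq_zero] at h0
      rcases h0 with h0 | h0
      · exact (Finset.prod_ne_zero_iff.mpr fun j _ => pow_ne_zero _ fun hx0 =>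
          RegularParameters.notMem_sq hli j (by rw [hx0]; exact Ideal.zero_mem _)) h0
      · -- `coord₀(u') = 0` forces `u' ∈ 𝔐`
        apply (IsLocalRing.mem_maximalIdeal _).mp ?_ hu'
        rw [hmaxB, maxIdeal_eq_comap hx, Ideal.mem_comap, augment_eq_mk_coord_zero, h0, map_zero]
        exact Ideal.zero_mem _
    -- `t = proj(u') · chart(v)`
    set v : Multiplicative (kummerCone p j₀ c) := Multiplicative.ofAdd ⟨liftNat p j₀ c k, liftNat_mem hk⟩
    have hchart : chart p x j₀ c v = rootMonomial p x k := chart_liftNat hk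
    have hproj : (t : RootCover p x) = proj p x j₀ c u' * chart p x j₀ c v := by
      conv_lhs => rw [← t.2, htk, ← hchart, mul_comm, ← coe_toricChart hc,
        proj_mul_of_proj_eq (toricChart p x j₀ c hc v).2, coe_toricChart, mul_comm]
    -- `proj u'` is a unit of `T`
    have hunit : IsUnit (⟨proj p x j₀ c u', proj_mem_toric u'⟩ : toric p x j₀ c) := by
      rw [← IsLocalRing.notMem_maximalIdeal, hmaxT, Ideal.mem_comap]
      intro hmem
      apply (IsLocalRing.mem_maximalIdeal _).mp ?_ hu'
      have : u' = (u' - proj p x j₀ c u') + proj p x j₀ c u' := (sub_add_cancel _ _).symm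
      rw [this]
      refine Ideal.add_mem _ ?_ hmem
      rw [hmaxB]
      exact Ideal.mem_sup_right (sub_proj_mem_span_root u')
    refine Submonoid.mem_sup.mpr ⟨_, hunit, toricChart p x j₀ c hc v, ⟨v, rfl⟩, Subtype.ext ?_⟩
    rw [Subalgebra.coe_mul, coe_toricChart, ← hproj]
  · refine sup_le (fun t ht => isUnit_mem_divisorialMonoid _ ht) ?_
    rintro _ ⟨v, rfl⟩
    obtain ⟨N, hN⟩ := toricChart_dvd_pow (x := x) hc v
    exact mem_divisorialMonoid_span_singleton_iff.mpr ⟨N, hN⟩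

end RootCover

end Literature.AlgebraicGeometry.Resolution

end
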